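import Mathlib
import HarnessLib
import Summits.Ventures.LatticeQCDFlow.Exactness.U1UniformJitterHMC
import Summits.Ventures.LatticeQCDFlow.Exactness.NCMCGeneralSpaceTauIntWindowConsistency
import Summits.Ventures.LatticeQCDFlow.Exactness.NCMCGeneralSpaceDoeblinPowerEveryStart
import Summits.Ventures.LatticeQCDFlow.Scoring.DoeblinPowerBatchMeansTauInt
import Summits.Ventures.LatticeQCDFlow.Scoring.ChainGlivenkoCantelli
import Summits.Ventures.LatticeQCDFlow.Exactness.NCMCGeneralSpaceGammaMethodWindow

/-!
# Statistics of a run of the `u1_2d` engine's HMC with the transplanted `tau_jitter` law: the printed Γ-method `τ̂_int,W` is consistent, strong laws from every start, exponential decorrelation — whenever `τ(1 − j) < τ₀(d, c)`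

HONEST FRAMING: exact (Metropolis-corrected) sampling algorithms for lattice gauge theory;
figures of merit are autocorrelation/cost numbers at stated couplings and volumes; no
continuum-physics claim.

Venture `LatticeQCDFlow` (cell pub-lqcd), topic `Exactness`, FANOUT row 9 (eng-latcore, GEN-25).  ENGINE READING (honest): in latflow.core 0.2.6 the `tau_jitter` option exists ONLY in `hmc.HMC.trajectory` (4D SU(N) `GaugeField`, 0.2.1+) and `phi4_2d.hmc`; `u1_2d.U1Field2D.hmc_trajectory(beta, rng, tau, nstep)` has NO such option, so the kernel
`u1UniformJitterHMC` of `U1UniformJitterHMC.lean` is the u1_2d HMC kernel WITH THE `hmc.py` RECIPE `tau_t = tau·(1 + tau_jitter·(2u − 1))`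
TRANSPLANTED (what `hmc_trajectory` would run if given the option — a one-line change; NOT an engine path today).  NEW WORK of the cell: the `U(1)` twin (transplanted `tau_jitter` law) of
GEN-24's `WilsonUniformJitterHMCStatistics.lean` (SU(N)), over GEN-25's `U1UniformJitterHMC.lean` (the kernel
`u1UniformJitterHMC ρ β c κ n τ j`, exact for every parameter; `wilson_u1UniformJitterHMC_certificate`: ONE one-hit Doeblin
constant whenever `τ(1 − j) < u1EngineTrajThreshold d c = 1/(32(d−1)|c|+1)`) and the generic theorems of rows 13/31/8
(`GeneralNCMC.chain_gammaHat_tendstoInMeasure_of_nHit`, `chain_tauIntWindow_{,indicator_}tendstoInMeasure_of_nHit`,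
`tendsto_sum_div_anyLaw_of_nHit_minorised`, `Scoring.chain_sampleVariance_ae_tendsto_of_nHit`,
`GeneralNCMC.abs_autocov_centred_le_of_nHit`, `GeneralNCMC.decay_of_nHit`).  Nothing is cited as a fact; no number is claimed.

## Content (`K = u1UniformJitterHMC ρ β c κ n τ j`, `π = wilsonMeasure ρ β`; every theorem: continuous `ρ`, `κ > 0`,
## `n ≥ 1`, `τ > 0`, `0 < j ≤ 1`, `τ(1 − j) < u1EngineTrajThreshold d c` — so `j = 1` qualifies at EVERY `τ`)

* Γ-METHOD: **`wilson_u1UniformJitterHMC_gammaHat_tendstoInMeasure`** (every lag `Γ̂_N(t) → C_f̄(t)` in probability, every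
  start), **`wilson_u1UniformJitterHMC_tauIntWindow_tendstoInMeasure`** (the printed `τ̂_int,W → τ_f` when `Var_π f > 0`,
  `W_N → ∞`, `W_N³/N → 0`), **`wilson_u1UniformJitterHMC_tauIntWindow_indicator_tendstoInMeasure`** (event: `→` the
  FITNESS `tauInt (setACF K π A)`).
* STRONG LAWS FROM EVERY START: **`wilson_u1UniformJitterHMC_timeAverage_ae_tendsto`** (ergodic theorem for EVERY
  `π`-integrable `φ`), **`wilson_u1UniformJitterHMC_sampleVariance_ae_tendsto`**.
* EXPONENTIAL DECORRELATION: **`wilson_u1UniformJitterHMC_abs_autocov_le`** (`|C_f̄(t)| ≤ 2(2C)²(1−ε′)^t` for EVERY bounded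
  observable), **`wilson_u1UniformJitterHMC_relaxation_le`** (thermalisation `|(Kᵗg)(U)| ≤ 2C_g(1−ε′)^t` from ANY start).

NOT CLAIMED: any value of the constants; anything when `τ(1 − j) ≥ τ₀(d, c)`; unbounded observables; floating point.
-/

noncomputable section

namespace Summit.Ventures.LatticeQCDFlow.Exactness

open MeasureTheory ProbabilityTheory ProbabilityTheory.Kernel Set Function Filter Topology
open Literature.MathematicalPhysics.QuantumFieldTheory
open Summit.Ventures.LatticeQCDFlow.Scoring (tauInt autocov rhoHat gammaHat tauIntWindow kop)
open scoped ENNReal NNReal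

set_option backward.isDefEq.respectTransparency false

section Statistics

variable {d L N : ℕ} [NeZero L] (ρ : Circle →* Matrix (Fin N) (Fin N) ℂ)

/-- The one-hit certificate of the engine with the transplanted law, in `nHit` form (from `wilson_u1UniformJitterHMC_certificate`). -/
theorem wilson_u1UniformJitterHMC_nHit_one (hρ : Continuous ρ) (β c : ℝ) {κ : ℝ} (hκ : 0 < κ) {n : ℕ} (hn : 1 ≤ n)
    {τ j : ℝ} (hτ : 0 < τ) (hj : 0 < j) (hj1 : j ≤ 1) (hshort : τ * (1 - j) < u1EngineTrajThreshold d c) :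
    Kernel.Invariant (u1UniformJitterHMC (d := d) (L := L) ρ β c κ n τ j) (wilsonMeasure (d := d) (L := L) ρ β) ∧
      ∃ ε' : ℝ≥0∞, 0 < ε' ∧ ε' ≤ 1 ∧ ∀ U : GaugeConfig d L Circle,
        ε' • Measure.pi (fun _ : Edge d L => haarProbability Circle) ≤
          nHit (u1UniformJitterHMC (d := d) (L := L) ρ β c κ n τ j) 1 U := by
  obtain ⟨hinv, ε', hε0, hε1, hmin⟩ := wilson_u1UniformJitterHMC_certificate (d := d) (L := L) ρ hρ β c hκ hn hτ hj hj1 hshort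
  exact ⟨hinv, ε', hε0, hε1, fun U => by rw [GeneralNCMC.nHit_one]; exact hmin U⟩

/-! ## §1 The Γ-method estimates are consistent from every start -/

/-- **EVERY LAG ESTIMATE IS CONSISTENT, FROM EVERY START**: for every bounded measurable `f`, every lag `t` and every
initial law `μ₀`, `Γ̂_N(t) → C_f̄(t)` in `P_{μ₀}`-probability. -/
theorem wilson_u1UniformJitterHMC_gammaHat_tendstoInMeasure (hρ : Continuous ρ) (β c : ℝ) {κ : ℝ} (hκ : 0 < κ)
    {n : ℕ} (hn : 1 ≤ n) {τ j : ℝ} (hτ : 0 < τ) (hj : 0 < j) (hj1 : j ≤ 1)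
    (hshort : τ * (1 - j) < u1EngineTrajThreshold d c)
    [IsMarkovKernel (u1UniformJitterHMC (d := d) (L := L) ρ β c κ n τ j)]
    {f : GaugeConfig d L Circle → ℝ} (hf : Measurable f) {C : ℝ} (hC : ∀ U, |f U| ≤ C) (t : ℕ)
    (μ₀ : Measure (GaugeConfig d L Circle)) [IsProbabilityMeasure μ₀] :
    TendstoInMeasure (Kernel.trajMeasure (X := fun _ : ℕ => GaugeConfig d L Circle) μ₀
          (fun m : ℕ => (u1UniformJitterHMC (d := d) (L := L) ρ β c κ n τ j).comap
            (fun h : (i : ↥(Finset.Iic m)) → GaugeConfig d L Circle => h ⟨m, Finset.mem_Iic.2 le_rfl⟩)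
            (measurable_pi_apply _)))
      (fun (m : ℕ) (x : ℕ → GaugeConfig d L Circle) => gammaHat (fun i => f (x i)) m t)
      atTop (fun _ => autocov (u1UniformJitterHMC (d := d) (L := L) ρ β c κ n τ j) (wilsonMeasure (d := d) (L := L) ρ β)
        (fun y => f y - ∫ z, f z ∂(wilsonMeasure (d := d) (L := L) ρ β)) t) := by
  haveI := isProbabilityMeasure_wilsonMeasure (d := d) (L := L) ρ hρ β
  obtain ⟨hinv, ε', hε0, -, hmin⟩ := wilson_u1UniformJitterHMC_nHit_one (d := d) (L := L) ρ hρ β c hκ hn hτ hj hj1 hshort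
  exact GeneralNCMC.chain_gammaHat_tendstoInMeasure_of_nHit μ₀ hinv hε0.ne' hmin Nat.one_pos hf hC t

/-- **THE PRINTED `τ̂_int,W` IS CONSISTENT, FROM EVERY START**: for every bounded measurable `f` with `Var_π f > 0`, every
initial law and every window sequence `W_N → ∞` with `W_N³/N → 0`,
`tauIntWindow (rhoHat (f ∘ U) N) (W N) → τ_f = σ²_f/(2 C_f̄(0))` in probability. -/
theorem wilson_u1UniformJitterHMC_tauIntWindow_tendstoInMeasure (hρ : Continuous ρ) (β c : ℝ) {κ : ℝ} (hκ : 0 < κ)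
    {n : ℕ} (hn : 1 ≤ n) {τ j : ℝ} (hτ : 0 < τ) (hj : 0 < j) (hj1 : j ≤ 1)
    (hshort : τ * (1 - j) < u1EngineTrajThreshold d c)
    [IsMarkovKernel (u1UniformJitterHMC (d := d) (L := L) ρ β c κ n τ j)]
    {f : GaugeConfig d L Circle → ℝ} (hf : Measurable f) {C : ℝ} (hC : ∀ U, |f U| ≤ C)
    (hvar : 0 < autocov (u1UniformJitterHMC (d := d) (L := L) ρ β c κ n τ j) (wilsonMeasure (d := d) (L := L) ρ β)
      (fun y => f y - ∫ z, f z ∂(wilsonMeasure (d := d) (L := L) ρ β)) 0)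
    (μ₀ : Measure (GaugeConfig d L Circle)) [IsProbabilityMeasure μ₀] {W : ℕ → ℕ} (hW : Tendsto W atTop atTop)
    (hW3 : Tendsto (fun m => (W m : ℝ) ^ 3 / m) atTop (nhds 0)) :
    TendstoInMeasure (Kernel.trajMeasure (X := fun _ : ℕ => GaugeConfig d L Circle) μ₀
          (fun m : ℕ => (u1UniformJitterHMC (d := d) (L := L) ρ β c κ n τ j).comap
            (fun h : (i : ↥(Finset.Iic m)) → GaugeConfig d L Circle => h ⟨m, Finset.mem_Iic.2 le_rfl⟩)
            (measurable_pi_apply _)))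
      (fun (m : ℕ) (x : ℕ → GaugeConfig d L Circle) => tauIntWindow (rhoHat (fun i => f (x i)) m) (W m))
      atTop (fun _ =>
        (autocov (u1UniformJitterHMC (d := d) (L := L) ρ β c κ n τ j) (wilsonMeasure (d := d) (L := L) ρ β)
            (fun y => f y - ∫ z, f z ∂(wilsonMeasure (d := d) (L := L) ρ β)) 0
          + 2 * ∑' t, autocov (u1UniformJitterHMC (d := d) (L := L) ρ β c κ n τ j) (wilsonMeasure (d := d) (L := L) ρ β)
            (fun y => f y - ∫ z, f z ∂(wilsonMeasure (d := d) (L := L) ρ β)) (t + 1))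
        / (2 * autocov (u1UniformJitterHMC (d := d) (L := L) ρ β c κ n τ j) (wilsonMeasure (d := d) (L := L) ρ β)
            (fun y => f y - ∫ z, f z ∂(wilsonMeasure (d := d) (L := L) ρ β)) 0)) := by
  haveI := isProbabilityMeasure_wilsonMeasure (d := d) (L := L) ρ hρ β
  obtain ⟨hinv, ε', hε0, -, hmin⟩ := wilson_u1UniformJitterHMC_nHit_one (d := d) (L := L) ρ hρ β c hκ hn hτ hj hj1 hshort
  exact GeneralNCMC.chain_tauIntWindow_tendstoInMeasure_of_nHit μ₀ hinv hε0.ne' hmin Nat.one_pos hf hC hvar hW hW3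

/-- **FOR AN EVENT, THE PRINTED `τ̂_int,W` CONVERGES TO THE FITNESS `τ_int`**: every measurable `A` with
`0 < π(A) < 1`, every initial law, every window sequence `W_N → ∞` with `W_N³/N → 0`. -/
theorem wilson_u1UniformJitterHMC_tauIntWindow_indicator_tendstoInMeasure (hρ : Continuous ρ) (β c : ℝ) {κ : ℝ}
    (hκ : 0 < κ) {n : ℕ} (hn : 1 ≤ n) {τ j : ℝ} (hτ : 0 < τ) (hj : 0 < j) (hj1 : j ≤ 1)
    (hshort : τ * (1 - j) < u1EngineTrajThreshold d c)
    [IsMarkovKernel (u1UniformJitterHMC (d := d) (L := L) ρ β c κ n τ j)]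
    {A : Set (GaugeConfig d L Circle)} (hA : MeasurableSet A) (h0 : 0 < (wilsonMeasure (d := d) (L := L) ρ β).real A)
    (h1 : (wilsonMeasure (d := d) (L := L) ρ β).real A < 1)
    (μ₀ : Measure (GaugeConfig d L Circle)) [IsProbabilityMeasure μ₀] {W : ℕ → ℕ} (hW : Tendsto W atTop atTop)
    (hW3 : Tendsto (fun m => (W m : ℝ) ^ 3 / m) atTop (nhds 0)) :
    TendstoInMeasure (Kernel.trajMeasure (X := fun _ : ℕ => GaugeConfig d L Circle) μ₀
          (fun m : ℕ => (u1UniformJitterHMC (d := d) (L := L) ρ β c κ n τ j).comap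
            (fun h : (i : ↥(Finset.Iic m)) → GaugeConfig d L Circle => h ⟨m, Finset.mem_Iic.2 le_rfl⟩)
            (measurable_pi_apply _)))
      (fun (m : ℕ) (x : ℕ → GaugeConfig d L Circle) =>
        tauIntWindow (rhoHat (fun i => A.indicator (1 : GaugeConfig d L Circle → ℝ) (x i)) m) (W m))
      atTop (fun _ => tauInt (setACF (u1UniformJitterHMC (d := d) (L := L) ρ β c κ n τ j)
        (wilsonMeasure (d := d) (L := L) ρ β) A)) := by
  haveI := isProbabilityMeasure_wilsonMeasure (d := d) (L := L) ρ hρ β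
  obtain ⟨hinv, ε', hε0, -, hmin⟩ := wilson_u1UniformJitterHMC_nHit_one (d := d) (L := L) ρ hρ β c hκ hn hτ hj hj1 hshort
  exact GeneralNCMC.chain_tauIntWindow_indicator_tendstoInMeasure_of_nHit μ₀ hinv hε0.ne' hmin Nat.one_pos hA h0 h1 hW hW3

/-! ## §2 Strong laws from every start -/

/-- **THE ERGODIC THEOREM FROM EVERY START**: for EVERY `π`-integrable measurable `φ` and EVERY initial law `μ₀`,
`(1/m) Σ_{i<m} φ(U_i) → ∫ φ dπ` almost surely. -/
theorem wilson_u1UniformJitterHMC_timeAverage_ae_tendsto (hρ : Continuous ρ) (β c : ℝ) {κ : ℝ} (hκ : 0 < κ)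
    {n : ℕ} (hn : 1 ≤ n) {τ j : ℝ} (hτ : 0 < τ) (hj : 0 < j) (hj1 : j ≤ 1)
    (hshort : τ * (1 - j) < u1EngineTrajThreshold d c)
    [IsMarkovKernel (u1UniformJitterHMC (d := d) (L := L) ρ β c κ n τ j)]
    {φ : GaugeConfig d L Circle → ℝ} (hφm : Measurable φ) (hφ : Integrable φ (wilsonMeasure (d := d) (L := L) ρ β))
    (μ₀ : Measure (GaugeConfig d L Circle)) [IsProbabilityMeasure μ₀] :
    ∀ᵐ x ∂(Kernel.trajMeasure (X := fun _ : ℕ => GaugeConfig d L Circle) μ₀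
          (fun m : ℕ => (u1UniformJitterHMC (d := d) (L := L) ρ β c κ n τ j).comap
            (fun h : (i : ↥(Finset.Iic m)) → GaugeConfig d L Circle => h ⟨m, Finset.mem_Iic.2 le_rfl⟩)
            (measurable_pi_apply _))),
      Tendsto (fun m : ℕ => (∑ i ∈ Finset.range m, φ (x i)) / m) atTop
        (𝓝 (∫ a, φ a ∂(wilsonMeasure (d := d) (L := L) ρ β))) := by
  haveI := isProbabilityMeasure_wilsonMeasure (d := d) (L := L) ρ hρ β
  obtain ⟨hinv, ε', hε0, -, hmin⟩ := wilson_u1UniformJitterHMC_nHit_one (d := d) (L := L) ρ hρ β c hκ hn hτ hj hj1 hshort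
  exact GeneralNCMC.tendsto_sum_div_anyLaw_of_nHit_minorised hinv hε0.ne' hmin hφm hφ μ₀

/-- **THE SAMPLE VARIANCE IS STRONGLY CONSISTENT, EVERY START**: for `|f| ≤ C` measurable and every `μ₀`,
`(1/m) Σ f(U_t)² − ((1/m) Σ f(U_t))² → Var_π f` almost surely. -/
theorem wilson_u1UniformJitterHMC_sampleVariance_ae_tendsto (hρ : Continuous ρ) (β c : ℝ) {κ : ℝ} (hκ : 0 < κ)
    {n : ℕ} (hn : 1 ≤ n) {τ j : ℝ} (hτ : 0 < τ) (hj : 0 < j) (hj1 : j ≤ 1)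
    (hshort : τ * (1 - j) < u1EngineTrajThreshold d c)
    [IsMarkovKernel (u1UniformJitterHMC (d := d) (L := L) ρ β c κ n τ j)]
    {f : GaugeConfig d L Circle → ℝ} (hf : Measurable f) {C : ℝ} (hC : ∀ U, |f U| ≤ C)
    (μ₀ : Measure (GaugeConfig d L Circle)) [IsProbabilityMeasure μ₀] :
    ∀ᵐ x ∂(Kernel.trajMeasure (X := fun _ : ℕ => GaugeConfig d L Circle) μ₀
          (fun m : ℕ => (u1UniformJitterHMC (d := d) (L := L) ρ β c κ n τ j).comap
            (fun h : (i : ↥(Finset.Iic m)) → GaugeConfig d L Circle => h ⟨m, Finset.mem_Iic.2 le_rfl⟩)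
            (measurable_pi_apply _))),
      Tendsto (fun m : ℕ => (∑ t ∈ Finset.range m, f (x t) ^ 2) / m - ((∑ t ∈ Finset.range m, f (x t)) / m) ^ 2) atTop
        (𝓝 (∫ z, (f z - ∫ z', f z' ∂(wilsonMeasure (d := d) (L := L) ρ β)) ^ 2 ∂(wilsonMeasure (d := d) (L := L) ρ β))) := by
  haveI := isProbabilityMeasure_wilsonMeasure (d := d) (L := L) ρ hρ β
  obtain ⟨hinv, ε', hε0, -, hmin⟩ := wilson_u1UniformJitterHMC_nHit_one (d := d) (L := L) ρ hρ β c hκ hn hτ hj hj1 hshort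
  exact Scoring.chain_sampleVariance_ae_tendsto_of_nHit hinv hmin hε0 hf hC μ₀

/-! ## §3 Exponential decorrelation -/

/-- **ONE GEOMETRIC RATE FOR THE AUTOCOVARIANCE OF EVERY BOUNDED OBSERVABLE**: some `0 < ε′ ≤ 1` with
`|C_f̄(t)| ≤ 2(2C)²(1 − ε′)^t` for every `|f| ≤ C` measurable and every lag `t`. -/
theorem wilson_u1UniformJitterHMC_abs_autocov_le (hρ : Continuous ρ) (β c : ℝ) {κ : ℝ} (hκ : 0 < κ)
    {n : ℕ} (hn : 1 ≤ n) {τ j : ℝ} (hτ : 0 < τ) (hj : 0 < j) (hj1 : j ≤ 1)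
    (hshort : τ * (1 - j) < u1EngineTrajThreshold d c) :
    ∃ ε' : ℝ≥0∞, 0 < ε' ∧ ε' ≤ 1 ∧
      ∀ (f : GaugeConfig d L Circle → ℝ), Measurable f → ∀ C : ℝ, (∀ U, |f U| ≤ C) →
        ∀ t : ℕ, |autocov (u1UniformJitterHMC (d := d) (L := L) ρ β c κ n τ j) (wilsonMeasure (d := d) (L := L) ρ β)
            (fun y => f y - ∫ z, f z ∂(wilsonMeasure (d := d) (L := L) ρ β)) t| ≤ 2 * (2 * C) ^ 2 * (1 - ε'.toReal) ^ t := by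
  haveI := isProbabilityMeasure_wilsonMeasure (d := d) (L := L) ρ hρ β
  haveI := isMarkovKernel_u1UniformJitterHMC (d := d) (L := L) ρ hρ β c hκ n τ j
  obtain ⟨hinv, ε', hε0, hε1, hmin⟩ := wilson_u1UniformJitterHMC_nHit_one (d := d) (L := L) ρ hρ β c hκ hn hτ hj hj1 hshort
  refine ⟨ε', hε0, hε1, fun f hf C hC t => ?_⟩
  simpa only [Nat.div_one] using GeneralNCMC.abs_autocov_centred_le_of_nHit (GeneralNCMC.minorised_setwise hmin) hε1
    hinv hf hC t

/-- **THERMALISATION OF OBSERVABLES FROM ANY START**: same `ε′`; for every centred bounded measurable `g`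
(`∫ g dπ = 0`, `|g| ≤ C_g`), every `t` and EVERY configuration `U`, `|(Kᵗ g)(U)| ≤ 2 C_g (1 − ε′)^t`. -/
theorem wilson_u1UniformJitterHMC_relaxation_le (hρ : Continuous ρ) (β c : ℝ) {κ : ℝ} (hκ : 0 < κ)
    {n : ℕ} (hn : 1 ≤ n) {τ j : ℝ} (hτ : 0 < τ) (hj : 0 < j) (hj1 : j ≤ 1)
    (hshort : τ * (1 - j) < u1EngineTrajThreshold d c) :
    ∃ ε' : ℝ≥0∞, 0 < ε' ∧ ε' ≤ 1 ∧
      ∀ (g : GaugeConfig d L Circle → ℝ), Measurable g → ∀ Cg : ℝ, (∀ U, |g U| ≤ Cg) →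
        ∫ U, g U ∂(wilsonMeasure (d := d) (L := L) ρ β) = 0 →
        ∀ (t : ℕ) (U : GaugeConfig d L Circle),
          |(kop (u1UniformJitterHMC (d := d) (L := L) ρ β c κ n τ j))^[t] g U| ≤ 2 * Cg * (1 - ε'.toReal) ^ t := by
  haveI := isProbabilityMeasure_wilsonMeasure (d := d) (L := L) ρ hρ β
  haveI := isMarkovKernel_u1UniformJitterHMC (d := d) (L := L) ρ hρ β c hκ n τ j
  obtain ⟨hinv, ε', hε0, hε1, hmin⟩ := wilson_u1UniformJitterHMC_nHit_one (d := d) (L := L) ρ hρ β c hκ hn hτ hj hj1 hshort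
  refine ⟨ε', hε0, hε1, fun g hg Cg hCg hg0 t U => ?_⟩
  simpa only [Nat.div_one] using GeneralNCMC.decay_of_nHit (GeneralNCMC.minorised_setwise hmin) hε1 hinv g hg Cg hCg hg0 t U

end Statistics

end Summit.Ventures.LatticeQCDFlow.Exactness

end
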